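import Mathlib
import Literature.Computability.Complexity.RangeAvoidance
import Summits.PneNP.PneNP.Theorems.PstarPDT
import Summits.PneNP.PneNP.Theorems.PstarGapLemma

/-!
# The depth adversary from the gap bound (ROUND-24 item T24.7): `PstarGapLemma.GapAdversary` by name

FRONTIER range-avoidance ladder, rung F-N3, ROUND 24 (cell `pnp-ideate`; restricted-model proof complexity — nothing here bears
on `P` versus `NP`).

`PstarGapLemma.GapAdversary`: if `GapBound K r I y` holds (every minimal `W`-infeasible set of at most `r` outputs has size
`≤ K·|W|`, for every parity-constraint system `W`), then every parity decision tree solving the falsified-output search problem of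
the fibre `I(z) = y` has depth `d` with `r ≤ 2·K·d + 1`.  Pure combinatorics of parity decision trees (any locality `k`, no `P⋆`
inside).

**Proof (the adversary).**  Follow the play down the tree, collecting the answered queries in a constraint system `W`
(`|W| ≤` number of queries so far) and maintaining the invariant "`W` is `r`-FEASIBLE" (`RFeasible I y r W`: every `≤ r` outputs
are jointly satisfiable together with `W`).
* START (`rFeasible_of_gapBound`): `W = ∅` is `r`-feasible — an infeasible `J` contains a minimal infeasible `J' ⊆ J`
  (`exists_minInfeasible_subset`), of size `≤ K·0 = 0`, but `∅` is feasible.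
* HALVING (`halving`, free): if `W` is `r`-feasible then for every query `S` one of `W ∪ {S = b}` is `⌊r/2⌋`-feasible — otherwise
  infeasible `J₀`, `J₁` of size `≤ ⌊r/2⌋` on the two sides give `J₀ ∪ J₁` of size `≤ r`, feasible in `W` by a witness `z` whose
  parity on `S` picks a side.
* RECOVERY (`recovery`, the gap bound): an `s`-feasible `W'` with `K·|W'| ≤ s` is `r`-feasible (a minimal infeasible subset of an
  infeasible `J`, `|J| ≤ r`, has size `≤ K|W'| ≤ s`, so it is feasible).
* MAIN (`main`, induction on the tree generalising `W`): if `1 ≤ r`, `W` is `r`-feasible and `T` solves the search problem on the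
  solution set of `W`, then `⌊r/2⌋ < K·(|W| + depth T)`: a leaf `j` is refuted by the `1`-feasibility witness for `{j}`;
  at a node, take the `⌊r/2⌋`-feasible side `b`; if `K(|W|+1) > ⌊r/2⌋` we are done (depth `≥ 1`), else RECOVERY restores
  `r`-feasibility of `W ∪ {S = b}` and the subtree `T_b` solves the problem on its solution set.
* With `W = ∅`: `⌊r/2⌋ < K · depth T`, i.e. `r ≤ 2K·depth T − 1` (and `r = 0` is trivial).
-/

set_option linter.dupNamespace false -- `Summit.PneNP.PneNP.…`: summit = sub-problem name (D-0017 single-conjunct layout)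

open Finset Literature.Computability.Complexity
open Summit.PneNP.PneNP.Theorems.PstarPDT (PDT parity)
open Summit.PneNP.PneNP.Theorems.PstarGapLemma (Sat Feasible MinInfeasible RFeasible GapBound GapAdversary)

namespace Summit.PneNP.PneNP.Theorems.PstarGapAdversary

variable {k n m : ℕ} {I : LocalMap k n m} {y : Fin m → Bool}

/-! "`T` solves the search problem ON THE SOLUTION SET OF `W`" is written out as
`∀ z, Sat W z → I.eval z (T.run z) ≠ y (T.run z)` throughout (no auxiliary definition). -/

/-- A solving tree solves the problem on the solution set of the empty system. -/
theorem solvesOn_empty {T : PDT n m} (h : T.Solves I y) :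
    ∀ z : Fin n → Bool, Sat (∅ : Finset (Finset (Fin n) × Bool)) z → I.eval z (T.run z) ≠ y (T.run z) :=
  fun z _ => h z

/-- Adding a constraint that `z` satisfies keeps `z` a solution. -/
theorem sat_insert {W : Finset (Finset (Fin n) × Bool)} {z : Fin n → Bool} (hz : Sat W z) {S : Finset (Fin n)} {b : Bool}
    (hS : parity S z = b) : Sat (insert (S, b) W) z := by
  intro e he
  rcases mem_insert.mp he with rfl | he
  · exact hS
  · exact hz e he

/-- A solution of `W ∪ {S = b}` is a solution of `W` with parity `b` on `S`. -/
theorem sat_of_sat_insert {W : Finset (Finset (Fin n) × Bool)} {z : Fin n → Bool} {S : Finset (Fin n)} {b : Bool}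
    (hz : Sat (insert (S, b) W) z) : Sat W z ∧ parity S z = b :=
  ⟨fun e he => hz e (mem_insert_of_mem he), hz (S, b) (mem_insert_self _ _)⟩

/-- Every infeasible set of outputs contains a minimal infeasible one. -/
theorem exists_minInfeasible_subset (W : Finset (Finset (Fin n) × Bool)) :
    ∀ J : Finset (Fin m), ¬ Feasible I y W J → ∃ J' ⊆ J, MinInfeasible I y W J' := by
  intro J
  induction J using Finset.strongInduction with
  | H J ih =>
    intro hJ
    by_cases h : ∀ j ∈ J, Feasible I y W (J.erase j)
    · exact ⟨J, Subset.rfl, hJ, h⟩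
    · push Not at h
      obtain ⟨j, hj, hnf⟩ := h
      obtain ⟨J', hJ', hmin⟩ := ih (J.erase j) (erase_ssubset hj) hnf
      exact ⟨J', hJ'.trans (erase_subset j J), hmin⟩

/-- **RECOVERY.**  Under the gap bound, an `s`-feasible system `W` with `K·|W| ≤ s` is `r`-feasible. -/
theorem recovery {K r s : ℕ} (hG : GapBound K r I y) {W : Finset (Finset (Fin n) × Bool)} (hKW : K * W.card ≤ s)
    (hW : RFeasible I y s W) : RFeasible I y r W := by
  intro J hJ
  by_contra hnf
  obtain ⟨J', hJ'J, hmin⟩ := exists_minInfeasible_subset W J hnf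
  have h1 : J'.card ≤ K * W.card := hG W J' ((card_le_card hJ'J).trans hJ) hmin
  exact hmin.1 (hW J' (h1.trans hKW))

/-- **START.**  Under the gap bound the empty system is `r`-feasible. -/
theorem rFeasible_of_gapBound {K r : ℕ} (hG : GapBound K r I y) : RFeasible I y r ∅ := by
  refine recovery (s := 0) hG (by simp) ?_
  intro J hJ
  have hJ0 : J = ∅ := card_eq_zero.mp (Nat.le_zero.mp hJ)
  subst hJ0
  exact ⟨fun _ => false, PstarGapLemma.sat_empty _, fun j hj => absurd hj (notMem_empty j)⟩

/-- **HALVING.**  If `W` is `r`-feasible then for every query `S` one of the two answers keeps `⌊r/2⌋`-feasibility. -/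
theorem halving {r : ℕ} {W : Finset (Finset (Fin n) × Bool)} (hW : RFeasible I y r W) (S : Finset (Fin n)) :
    ∃ b : Bool, RFeasible I y (r / 2) (insert (S, b) W) := by
  by_contra h
  push Not at h
  have h0 := h false
  have h1 := h true
  simp only [RFeasible, not_forall] at h0 h1
  obtain ⟨J₀, hJ₀, hn₀⟩ := h0
  obtain ⟨J₁, hJ₁, hn₁⟩ := h1
  have hc : (J₀ ∪ J₁).card ≤ r := (card_union_le _ _).trans (by omega)
  obtain ⟨z, hz, hzJ⟩ := hW _ hc
  cases hp : parity S z
  · exact hn₀ ⟨z, sat_insert hz hp, fun j hj => hzJ j (mem_union_left _ hj)⟩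
  · exact hn₁ ⟨z, sat_insert hz hp, fun j hj => hzJ j (mem_union_right _ hj)⟩

/-- At a query node, the subtree for answer `b` solves the problem on the solution set of `W ∪ {S = b}`. -/
theorem solvesOn_child {W : Finset (Finset (Fin n) × Bool)} {S : Finset (Fin n)} {t₀ t₁ : PDT n m}
    (h : ∀ z : Fin n → Bool, Sat W z → I.eval z ((PDT.node S t₀ t₁).run z) ≠ y ((PDT.node S t₀ t₁).run z)) (b : Bool) :
    ∀ z : Fin n → Bool, Sat (insert (S, b) W) z →
      I.eval z ((if b then t₁ else t₀).run z) ≠ y ((if b then t₁ else t₀).run z) := by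
  intro z hz
  obtain ⟨hzW, hp⟩ := sat_of_sat_insert hz
  have := h z hzW
  simp only [PDT.run, hp] at this
  cases b
  · simpa using this
  · simpa using this

/-- **MAIN.**  Under the gap bound with `1 ≤ r`: if `W` is `r`-feasible and `T` solves the problem on the solution set of `W`, then
`⌊r/2⌋ < K · (|W| + depth T)`. -/
theorem main {K r : ℕ} (hG : GapBound K r I y) (hr : 1 ≤ r) :
    ∀ (T : PDT n m) (W : Finset (Finset (Fin n) × Bool)), RFeasible I y r W →
      (∀ z : Fin n → Bool, Sat W z → I.eval z (T.run z) ≠ y (T.run z)) → r / 2 < K * (W.card + T.depth) := by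
  intro T
  induction T with
  | leaf j =>
    intro W hW hS
    obtain ⟨z, hz, hzj⟩ := hW {j} (by simpa using hr)
    exact absurd (hzj j (mem_singleton_self j)) (hS z hz)
  | node S t₀ t₁ ih₀ ih₁ =>
    intro W hW hS
    obtain ⟨b, hb⟩ := halving hW S
    by_cases hK : r / 2 < K * (W.card + 1)
    · exact lt_of_lt_of_le hK (Nat.mul_le_mul_left _ (by simp [PDT.depth]))
    · push Not at hK
      have hcard : (insert (S, b) W).card ≤ W.card + 1 := card_insert_le _ _
      have hRb : RFeasible I y r (insert (S, b) W) :=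
        recovery hG ((Nat.mul_le_mul_left K hcard).trans hK) hb
      have hSb := solvesOn_child hS b
      cases b
      · have h0 := ih₀ _ hRb (by simpa using hSb)
        refine lt_of_lt_of_le h0 (Nat.mul_le_mul_left _ ?_)
        have : t₀.depth ≤ max t₀.depth t₁.depth := le_max_left _ _
        simp only [PDT.depth]
        omega
      · have h1 := ih₁ _ hRb (by simpa using hSb)
        refine lt_of_lt_of_le h1 (Nat.mul_le_mul_left _ ?_)
        have : t₁.depth ≤ max t₀.depth t₁.depth := le_max_right _ _
        simp only [PDT.depth]
        omega

/-- **T24.7 — the adversary from the gap bound, by name.**  `GapBound K r I y` forces every parity decision tree solving the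
falsified-output search problem of the fibre `y` to have depth `d` with `r ≤ 2·K·d + 1`. -/
theorem gapAdversary : GapAdversary := by
  intro k n m K r I y hG T hT
  rcases Nat.eq_zero_or_pos r with hr0 | hr
  · omega
  · have h := main hG hr T ∅ (rFeasible_of_gapBound hG) (solvesOn_empty hT)
    simp only [card_empty, zero_add] at h
    have h2 : r ≤ 2 * (r / 2) + 1 := by omega
    have h3 : 2 * (r / 2) + 2 ≤ 2 * (K * T.depth) := by omega
    calc r ≤ 2 * (r / 2) + 1 := h2
      _ ≤ 2 * K * T.depth + 1 := by rw [Nat.mul_assoc]; omega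

end Summit.PneNP.PneNP.Theorems.PstarGapAdversary
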